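import Summits.BirchSwinnertonDyer.BirchSwinnertonDyer.Theses.UniversalToricDescent
import Summits.BirchSwinnertonDyer.BirchSwinnertonDyer.Theorems.SchneiderFreeAdditiveX3AnticycControlAdditiveNoLocalPTorsionOfFacts
import Summits.BirchSwinnertonDyer.BirchSwinnertonDyer.Theorems.SchneiderFreeAdditiveX3AnticycControlAdditiveRegimeB1
import Summits.BirchSwinnertonDyer.BirchSwinnertonDyer.Theorems.LocalTowerTorsionFiniteOfNoStableDivisibleLine
import Summits.BirchSwinnertonDyer.BirchSwinnertonDyer.Theorems.LocalTowerMovesPTorsionOfNoRootsOfUnity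
import Literature.NumberTheory.EllipticCurves.HeegnerPointsKolyvaginTorsionProofs
import HarnessLib

/-!
# Route `UniversalToricDescent`, crux #5 `WildSplitControlAtThree` (item stmt-BirchSwinnertonDyer-20386):
# the anticyclotomic control EQUALITY at a WILD potentially supersingular split `3` is the K1 door theorem

Seat `bsd-potss-kmc`, gen 16 (cell `bsd-potss`; residual K9 19200 `WildRankOne` = the content of the
W-ALL leaf `WAllExclAddWildRankOne` that route `UniversalToricDescent` (bsd-wall-pss3, draft rev 1) attacks).

The crux asks, for `E/ℚ` on the attacked cell (`ClassO6 W 3`, `ρ̄_{E,3}` onto, `r_an = 1`, a Heegner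
datum over an imaginary quadratic Heegner field `K` — so the additive `3` SPLITS in `K` — with non-torsion
Heegner point `P`, Kolyvagin's theorem as antecedent), at every anticyclotomic frame `(κ, γ, 𝔭 ∣ 3)`, for the
pointwise control equality `SchneiderFree.AdditiveControlOnTreeAt 3 κ 𝔭 γ (embAt K 3 𝔭) P`:
`ord₃ f_ac(0) = ord₃ #Ш(E/K)[3^∞] + 2·(ord₃ log_ω P − ord₃[E(K):ℤP]) + ord₃ ∏_{w ∣ N⁺} c_w(E/K)`.
Its filed «why it might fail» reads «the count was derived (K1) on pot-ordinary/multiplicative cells».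

READING OF THE K1 KERNELS (route `SchneiderFreeAdditiveX3`, seat bsd-schneider-door-c4): the two pointwise
door theorems
`SchneiderFreeAdditiveX3.additiveControlOnTreeAt_of_facts_of_noPTorsionPadic` (frames with `E(ℚ_p)[p] = 0`)
and `SchneiderFreeAdditiveX3.additiveControlOnTreeAt_of_facts_of_localTowerTorsionFinite` (regime B1:
`E(K)[p] = 0`, Fin_v, non-splitting) carry NO potentially-ordinary, NO `ClassX3`, NO `N10.Locus`
hypothesis: only `Addv W p`, `p ≠ 2`, `K` imaginary quadratic with `p` split, `κ` anticyclotomic, a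
degree-one `𝔭`, `rank E(K) = 1`, `Ш(E/K)` finite, `P` non-torsion — the additive local index
`[E(ℚ_p):E₁(ℚ_p)] = c_p·#Ẽ_ns(𝔽_p)` with `Ẽ_ns ≅ 𝔾_a` is reduction-TYPE-free among additive primes, and
the control-map bijection `AcSelmer.IsAnticyclotomic.controlMap_bijective_of_splitBad_subset` uses no
unit-root line. Hence, on the wild potentially supersingular cell at `p = 3`:

* `wildSplitControlAtThree_noLocalThreeTorsion_of_facts` — the crux's conclusion at every frame of every
  cell datum with `E(ℚ₃)[3] = 0`, CLOSED MODULO the five cited facts of the K1 door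
  {`poitouTate_selmerStructure_duality`, `poitouTate_sha_tateDual`, `localEulerPoincareCharacteristic`,
  `fieldCdLE_two_of_numberField`, Brink Thm 2 `decomp_not_le_kerSubgroup_of_isAnticyclotomic`};
* **`wildSplitControlAtThree_of_facts`** — the crux BY NAME
  (`Theses.UniversalToricDescent.WildSplitControlAtThree`), CLOSED MODULO the same five facts + Brink
  Cor 1 (`decomp_not_le_kerSubgroup_above_of_isAnticyclotomic`) + Fin_v
  (`SchneiderFreeControlAtoms.LocalTowerTorsionFiniteClaim W 3`) demanded ONLY on cell curves with a
  non-zero `ℚ₃`-rational `3`-torsion point (`t₃ ≥ 1`); `E(K)[3] = 0` (regime B1) is free on the cell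
  from `ρ̄_{E,3}` onto (`torsionBy_eq_bot_of_isImaginaryQuadratic`, Gross 1991 §2), so regime B2 is EMPTY.

So the crux is not new mathematics at a potentially supersingular `3`: it has exactly the status of K1's
crux `AnticycControlAdditive` (t_p = 0 half + regime B1), and its one typed residual beyond PUBLISHED
cohomological facts is Fin_v — finiteness of `E(K̄)[3^∞]^{D_𝔭 ⊓ ker κ}` — on the `t₃ ≥ 1` cell rows (where
`V₃E|_{G_{ℚ₃}}` is irreducible, so no `D_𝔭`-stable line exists; not yet a tree theorem).
CONDITIONAL (named-fact hypotheses); closes nothing by itself; BSD is not proved by any of this; no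
statement of route `UniversalToricDescent` is altered.

References: [JetchevSkinnerWan2017] Thm. 3.3.1, §3.2–3.3 (arXiv:1512.06894 pp. 10–14); [Castella2018]
Thm. 2.3; [MilneADT2006] I 2.8, 4.10; [Brink2007] Thm. 2, Cor. 1; [Kolyvagin1990] Thm. A; [GrossLMS1991] §2.
-/

noncomputable section

open scoped Classical

open WeierstrassCurve NumberField IsDedekindDomain Field Literature.NumberTheory.EllipticCurves
  Literature.NumberTheory.EllipticCurves.ModularForms
  Literature.NumberTheory.EllipticCurves.GreenbergSelmer
  Literature.NumberTheory.GaloisRepresentations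
  Literature.NumberTheory.GaloisCohomology
  Literature.NumberTheory.EllipticCurves.Rank1Residual
  Literature.NumberTheory.EllipticCurves.Rank1Residual.Typed
  Summit.BirchSwinnertonDyer.Rank1Residual
  Summit.BirchSwinnertonDyer.Rank1Residual.Additive
  Summit.BirchSwinnertonDyer.Rank1Residual.X11b
  Summit.BirchSwinnertonDyer.Rank1Residual.X11b.AcSelmer
  Summit.BirchSwinnertonDyer.BirchSwinnertonDyer.Theorems.SchneiderFree
  Summit.BirchSwinnertonDyer.BirchSwinnertonDyer.Theorems.SchneiderFreeControlAtoms
  Summit.BirchSwinnertonDyer.BirchSwinnertonDyer.Theorems.SchneiderFreeAdditiveX3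

set_option linter.dupNamespace false

namespace Summit.BirchSwinnertonDyer.BirchSwinnertonDyer.Theorems.UniversalToricDescentControl

/-- `E(K)[p] = 0` in the `•`-form the K1 door consumes, from Gross's remark (`ρ̄_{E,p}` onto, `p` odd,
`[K : ℚ] = 2`). [cite: GrossLMS1991, §2 (sentence after (2.2))] -/
theorem forall_nsmul_eq_zero_of_hasSurjectiveModNGaloisRep (W : WeierstrassCurve ℚ) [W.IsElliptic]
    (K : Type) [Field K] [NumberField K] (hK : IsImaginaryQuadratic K) {p : ℕ} [hp : Fact p.Prime]
    (hp2 : p ≠ 2) (hρ : W.HasSurjectiveModNGaloisRep p) :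
    ∀ x : (W.baseChange K).toAffine.Point, p • x = 0 → x = 0 := by
  intro x hx
  have h := torsionBy_eq_bot_of_isImaginaryQuadratic W K hK hp.out hp2 hρ
  have hx' : x ∈ AddSubgroup.torsionBy (W.baseChange K).toAffine.Point (p : ℤ) :=
    AddSubgroup.torsionBy.nsmul_iff.mpr hx
  rw [h] at hx'
  exact (AddSubgroup.mem_bot).mp hx'

/-- **Crux #5 of route `UniversalToricDescent` on the frames WITHOUT local `3`-torsion, from the five cited
facts of the K1 door.** For every datum of the attacked cell (`ClassO6 W 3`, `ρ̄_{E,3}` onto, `r_an = 1`,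
Heegner field `K`, non-torsion Heegner point `P`, Kolyvagin's theorem as antecedent) with `E(ℚ₃)[3] = 0`,
and every anticyclotomic frame `(κ, γ, 𝔭 ∣ 3)` of degree one: `SchneiderFree.AdditiveControlOnTreeAt 3`.
This is `SchneiderFreeAdditiveX3.additiveControlOnTreeAt_of_facts_of_noPTorsionPadic` VERBATIM — that
theorem has no potentially-ordinary hypothesis (`Addv W 3` is `ClassO6.2.1`; `3` splits in `K` by the
Heegner hypothesis since `3 ∣ N`). CONDITIONAL on the five cited facts; closes nothing by itself.
[cite: JetchevSkinnerWan2017, Thm. 3.3.1 (arXiv:1512.06894 p. 11)] [cite: MilneADT2006, Ch. I, Thm. 4.10 and Thm. 2.8]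
[cite: Brink2007, Thm. 2] [cite: Kolyvagin1990, Thm. A] -/
theorem wildSplitControlAtThree_noLocalThreeTorsion_of_facts
    (hPT : ∀ (K : Type) [Field K] [NumberField K], poitouTate_selmerStructure_duality K)
    (hPT2 : ∀ (K : Type) [Field K] [NumberField K], poitouTate_sha_tateDual K)
    (hEP : ∀ (K : Type) [Field K] [NumberField K] (v : HeightOneSpectrum (𝓞 K)),
      localEulerPoincareCharacteristic (v.adicCompletion K))
    (hcd : fieldCdLE_two_of_numberField)
    (hBr : ∀ (K : Type) [Field K] [NumberField K] (p : ℕ) [Fact p.Prime],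
      ZpExtension.decomp_not_le_kerSubgroup_of_isAnticyclotomic K p) :
    ∀ (W : WeierstrassCurve ℚ) [W.IsElliptic] [W.IsGloballyMinimal] (N : ℕ) [NeZero N] (K : Type)
      [Field K] [NumberField K] (Dt : ModularParametrizationData W N)
      (H : HeegnerDatum N (NumberField.discr K)) (ι : K →+* ℂ) (P : (W.baseChange K).toAffine.Point),
      ClassO6 W 3 → W.HasSurjectiveModNGaloisRep 3 → W.analyticRank = 1 → W.conductorNorm ℤ = N →
      IsImaginaryQuadratic K → SatisfiesHeegnerHypothesis N K →
      (W.quadraticTwist (NumberField.discr K : ℚ)).entireLFunction 1 ≠ 0 →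
      WeierstrassCurve.Affine.Point.map ι.toRatAlgHom P = heegnerPointComplex Dt H →
      ¬ IsOfFinAddOrder P → kolyvagin N W K →
      (∀ R : (W.baseChange ℚ_[3]).toAffine.Point, 3 • R = 0 → R = 0) →
      ∀ (κ : ZpExtension K 3), κ.IsAnticyclotomic →
        ∀ (γ : Field.absoluteGaloisGroup K) [Fact (κ.IsTopGenerator γ)]
          (𝔭 : HeightOneSpectrum (𝓞 K)) (h𝔭 : ((3 : ℕ) : 𝓞 K) ∈ 𝔭.asIdeal)
          (he : 𝔭.asIdeal.ramificationIdx (𝓞 ℚ) = 1) (hf : 𝔭.asIdeal.inertiaDeg (𝓞 ℚ) = 1),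
          AdditiveControlOnTreeAt 3 κ 𝔭 γ (embAt K 3 𝔭 h𝔭 he hf) P := by
  intro W _ _ N _ K _ _ Dt H ι P hO6 _hsurj _hr hN hK hHe _hL1 hP hnt hKo hiv κ hκ γ _ 𝔭 h𝔭 he hf
  have hadd : Addv W 3 := hO6.2.1
  have hpN : 3 ∣ W.conductorNorm ℤ :=
    (W.dvd_conductorNorm_iff_not_hasGoodReductionAtPrime 3).mpr hadd.1
  have hsplit : SplitsIn K 3 := splitsIn_of_satisfiesHeegnerHypothesis hN hHe hpN
  obtain ⟨hrank, hSha⟩ := hKo hK hHe ⟨Dt, H, ι, hP⟩ hnt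
  exact additiveControlOnTreeAt_of_facts_of_noPTorsionPadic (hPT K) (hPT2 K) (hEP K) hcd (hBr K 3)
    hiv (by decide) hadd hK hsplit hκ γ 𝔭 h𝔭 he hf hrank hSha P hnt

/-- **Crux #5 of route `UniversalToricDescent` BY NAME (`Theses.UniversalToricDescent.WildSplitControlAtThree`,
item stmt-BirchSwinnertonDyer-20386), CLOSED MODULO the five cited facts of the K1 door, Brink's Cor. 1
(the primes above `3` do not split completely in the anticyclotomic tower) and Fin_v
(`SchneiderFreeControlAtoms.LocalTowerTorsionFiniteClaim W 3`) on the cell curves WITH a non-zero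
`ℚ₃`-rational `3`-torsion point.** Proof: split on `E(ℚ₃)[3] = 0`. If it holds, the `t₃ = 0` door
`additiveControlOnTreeAt_of_facts_of_noPTorsionPadic`; otherwise regime B1's door
`additiveControlOnTreeAt_of_facts_of_localTowerTorsionFinite`, whose extra inputs are `E(K)[3] = 0`
(free on the cell: `ρ̄_{E,3}` onto and `[K : ℚ] = 2`, Gross 1991 §2), Fin_v (the hypothesis `hFinV`) and
non-splitting (Brink Cor. 1). Neither door has a potentially-ordinary hypothesis. CONDITIONAL
(named-fact hypotheses + the Fin_v predicate); the item stays open until those are discharged or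
item-stated by its planner; BSD is not proved by any of this.
[cite: JetchevSkinnerWan2017, Thm. 3.3.1, Prop. 3.2.1, Prop. 3.3.4 (arXiv:1512.06894 pp. 10–13)]
[cite: Castella2018, Thm. 2.3 (arXiv:1704.06608 p. 5)] [cite: MilneADT2006, Ch. I, Thm. 4.10 and Thm. 2.8]
[cite: Brink2007, Thm. 2 and Cor. 1] [cite: Kolyvagin1990, Thm. A] [cite: GrossLMS1991, §2] -/
theorem wildSplitControlAtThree_of_facts
    (hPT : ∀ (K : Type) [Field K] [NumberField K], poitouTate_selmerStructure_duality K)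
    (hPT2 : ∀ (K : Type) [Field K] [NumberField K], poitouTate_sha_tateDual K)
    (hEP : ∀ (K : Type) [Field K] [NumberField K] (v : HeightOneSpectrum (𝓞 K)),
      localEulerPoincareCharacteristic (v.adicCompletion K))
    (hcd : fieldCdLE_two_of_numberField)
    (hBr : ∀ (K : Type) [Field K] [NumberField K] (p : ℕ) [Fact p.Prime],
      ZpExtension.decomp_not_le_kerSubgroup_of_isAnticyclotomic K p)
    (hBr2 : ∀ (K : Type) [Field K] [NumberField K] (p : ℕ) [Fact p.Prime],
      ZpExtension.decomp_not_le_kerSubgroup_above_of_isAnticyclotomic K p)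
    (hFinV : ∀ (W : WeierstrassCurve ℚ) [W.IsElliptic] [W.IsGloballyMinimal],
      ClassO6 W 3 → W.HasSurjectiveModNGaloisRep 3 → W.analyticRank = 1 →
      (∃ R : (W.baseChange ℚ_[3]).toAffine.Point, R ≠ 0 ∧ 3 • R = 0) →
      LocalTowerTorsionFiniteClaim W 3) :
    Summit.BirchSwinnertonDyer.BirchSwinnertonDyer.Theses.UniversalToricDescent.WildSplitControlAtThree := by
  intro W _ _ N _ K _ _ Dt H ι P hO6 hsurj hr hN hK hHe _hL1 hP hnt hKo κ hκ γ _ 𝔭 h𝔭 he hf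
  have hadd : Addv W 3 := hO6.2.1
  have hpN : 3 ∣ W.conductorNorm ℤ :=
    (W.dvd_conductorNorm_iff_not_hasGoodReductionAtPrime 3).mpr hadd.1
  have hsplit : SplitsIn K 3 := splitsIn_of_satisfiesHeegnerHypothesis hN hHe hpN
  obtain ⟨hrank, hSha⟩ := hKo hK hHe ⟨Dt, H, ι, hP⟩ hnt
  by_cases hiv : ∀ R : (W.baseChange ℚ_[3]).toAffine.Point, 3 • R = 0 → R = 0
  · exact additiveControlOnTreeAt_of_facts_of_noPTorsionPadic (hPT K) (hPT2 K) (hEP K) hcd (hBr K 3)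
      hiv (by decide) hadd hK hsplit hκ γ 𝔭 h𝔭 he hf hrank hSha P hnt
  · have hloc : ∃ R : (W.baseChange ℚ_[3]).toAffine.Point, R ≠ 0 ∧ 3 • R = 0 := by
      push Not at hiv
      obtain ⟨R, h3, hne⟩ := hiv
      exact ⟨R, hne, h3⟩
    have hivK : ∀ x : (W.baseChange K).toAffine.Point, 3 • x = 0 → x = 0 :=
      forall_nsmul_eq_zero_of_hasSurjectiveModNGaloisRep W K hK (by decide) hsurj
    exact additiveControlOnTreeAt_of_facts_of_localTowerTorsionFinite (hPT K) (hPT2 K) (hEP K) hcd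
      (hBr K 3) (by decide) hadd hK hsplit hκ γ 𝔭 h𝔭 he hf hivK
      (hFinV W hO6 hsurj hr hloc K hK hsplit κ hκ 𝔭 h𝔭) (hBr2 K 3 hK (by decide) κ hκ 𝔭 h𝔭)
      hrank hSha P hnt

/-- **Crux #5 of route `UniversalToricDescent` BY NAME, with Fin_v UNFOLDED (§2 append, gen 16):** CLOSED
MODULO the five cited facts of the K1 door, Brink Thm 2 / Cor 1, and — only on the cell curves with a
non-zero `ℚ₃`-rational `3`-torsion point, for every imaginary quadratic `K` with `3` split and every
`𝔭 ∋ 3` — the two LINE-FREE inputs of `WeierstrassCurve.localTowerTorsionFiniteAt_of_noStableDivisibleLine`: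
(i) `hIrr`: `E(K̄)[3^∞]` has no non-zero `D_𝔭`-stable `3`-divisible subgroup with `≤ 3` points of order
`3` (the torsion avatar of the irreducibility of `V₃E|_{G_{ℚ₃}}` at a prime of potentially supersingular
reduction — Serre 1972 / Fontaine; not yet a tree theorem), and (ii) `hMove`: for every anticyclotomic
`κ`, the local tower group `D_𝔭 ⊓ ker κ` moves some `3`-torsion point (Weil pairing + `ζ₃ ∉ ℚ₃`;
elementary, not yet plumbed to `decomp 𝔭`). So Fin_v is no longer a named predicate among the hypotheses:
what remains of crux #5 beyond published cohomology is local irreducibility at the wild prime.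
CONDITIONAL; closes nothing by itself; BSD is not proved by any of this.
[cite: JetchevSkinnerWan2017, Thm. 3.3.1, Prop. 3.3.4 (arXiv:1512.06894 pp. 11–13)]
[cite: GreenbergLNM1716, §3 Lemma 3.3 (p. 87)] [cite: MilneADT2006, Ch. I, Thm. 4.10 and Thm. 2.8]
[cite: Brink2007, Thm. 2 and Cor. 1] [cite: Kolyvagin1990, Thm. A] [cite: GrossLMS1991, §2] -/
theorem wildSplitControlAtThree_of_facts_of_noStableDivisibleLine
    (hPT : ∀ (K : Type) [Field K] [NumberField K], poitouTate_selmerStructure_duality K)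
    (hPT2 : ∀ (K : Type) [Field K] [NumberField K], poitouTate_sha_tateDual K)
    (hEP : ∀ (K : Type) [Field K] [NumberField K] (v : HeightOneSpectrum (𝓞 K)),
      localEulerPoincareCharacteristic (v.adicCompletion K))
    (hcd : fieldCdLE_two_of_numberField)
    (hBr : ∀ (K : Type) [Field K] [NumberField K] (p : ℕ) [Fact p.Prime],
      ZpExtension.decomp_not_le_kerSubgroup_of_isAnticyclotomic K p)
    (hBr2 : ∀ (K : Type) [Field K] [NumberField K] (p : ℕ) [Fact p.Prime],
      ZpExtension.decomp_not_le_kerSubgroup_above_of_isAnticyclotomic K p)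
    (hIrr : ∀ (W : WeierstrassCurve ℚ) [W.IsElliptic] [W.IsGloballyMinimal],
      ClassO6 W 3 → W.HasSurjectiveModNGaloisRep 3 → W.analyticRank = 1 →
      (∃ R : (W.baseChange ℚ_[3]).toAffine.Point, R ≠ 0 ∧ 3 • R = 0) →
      ∀ (K : Type) [Field K] [NumberField K], IsImaginaryQuadratic K → SplitsIn K 3 →
      ∀ (𝔭 : HeightOneSpectrum (𝓞 K)), ((3 : ℕ) : 𝓞 K) ∈ 𝔭.asIdeal →
      ∀ N : AddSubgroup ((W.baseChange K).geomPrimaryTorsion 3),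
        (∀ d ∈ decomp 𝔭, ∀ c ∈ N, d • c ∈ N) → (∀ c ∈ N, ∃ c' ∈ N, 3 • c' = c) →
        Set.ncard {c : (W.baseChange K).geomPrimaryTorsion 3 | c ∈ N ∧ 3 • c = 0} ≤ 3 → N = ⊥)
    (hMove : ∀ (W : WeierstrassCurve ℚ) [W.IsElliptic] [W.IsGloballyMinimal],
      ClassO6 W 3 → W.HasSurjectiveModNGaloisRep 3 → W.analyticRank = 1 →
      (∃ R : (W.baseChange ℚ_[3]).toAffine.Point, R ≠ 0 ∧ 3 • R = 0) →
      ∀ (K : Type) [Field K] [NumberField K], IsImaginaryQuadratic K → SplitsIn K 3 →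
      ∀ (κ : ZpExtension K 3), κ.IsAnticyclotomic →
      ∀ (𝔭 : HeightOneSpectrum (𝓞 K)), ((3 : ℕ) : 𝓞 K) ∈ 𝔭.asIdeal →
      ∃ m : (W.baseChange K).geomPrimaryTorsion 3, 3 • m = 0 ∧
        ∃ g ∈ decomp 𝔭 ⊓ κ.kerSubgroup, g • m ≠ m) :
    Summit.BirchSwinnertonDyer.BirchSwinnertonDyer.Theses.UniversalToricDescent.WildSplitControlAtThree :=
  wildSplitControlAtThree_of_facts hPT hPT2 hEP hcd hBr hBr2
    fun W _ _ hO6 hsurj hr hloc K _ _ hK hsplit κ hκ 𝔭 h𝔭 ↦ by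
      haveI : (W.baseChange K).IsElliptic := by rw [baseChange]; infer_instance
      exact (W.baseChange K).localTowerTorsionFiniteAt_of_noStableDivisibleLine 3 κ 𝔭
        (hIrr W hO6 hsurj hr hloc K hK hsplit 𝔭 h𝔭) (hMove W hO6 hsurj hr hloc K hK hsplit κ hκ 𝔭 h𝔭)

/-- **Crux #5 of route `UniversalToricDescent` BY NAME, modulo published cohomology and LOCAL
IRREDUCIBILITY ONLY (§3 append, gen 16).** Hypothesis (ii) `hMove` of the previous theorem is DISCHARGED
by `WeierstrassCurve.exists_pTorsion_not_fixed_of_degreeOne` (Weil pairing + `ζ₃ ∉ ℚ₃`: at a degree-one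
`𝔭 ∣ 3` of the Heegner field the local tower group moves a `3`-torsion point). What the crux needs beyond
the five cited facts of the K1 door and Brink's Thm 2 / Cor 1 is therefore EXACTLY `hIrr`: on the cell
curves with a `ℚ₃`-rational `3`-torsion point, `E(K̄)[3^∞]` has no non-zero `D_𝔭`-stable `3`-divisible
subgroup with `≤ 3` points of order `3` — the torsion avatar of «`V₃E|_{G_{ℚ₃}}` is irreducible at a
prime of potentially supersingular reduction» (Serre 1972; Fontaine), a published fact not yet typed in
the tree. CONDITIONAL; closes nothing by itself; BSD is not proved by any of this.
[cite: JetchevSkinnerWan2017, Thm. 3.3.1 (arXiv:1512.06894 p. 11)] [cite: SilvermanAEC2009, Cor. III.8.1.1]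
[cite: Serre1973, Ch. II §3.1 Prop. 7] [cite: MilneADT2006, Ch. I, Thm. 4.10 and Thm. 2.8]
[cite: Brink2007, Thm. 2 and Cor. 1] [cite: Kolyvagin1990, Thm. A] -/
theorem wildSplitControlAtThree_of_facts_of_localIrreducibility
    (hPT : ∀ (K : Type) [Field K] [NumberField K], poitouTate_selmerStructure_duality K)
    (hPT2 : ∀ (K : Type) [Field K] [NumberField K], poitouTate_sha_tateDual K)
    (hEP : ∀ (K : Type) [Field K] [NumberField K] (v : HeightOneSpectrum (𝓞 K)),
      localEulerPoincareCharacteristic (v.adicCompletion K))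
    (hcd : fieldCdLE_two_of_numberField)
    (hBr : ∀ (K : Type) [Field K] [NumberField K] (p : ℕ) [Fact p.Prime],
      ZpExtension.decomp_not_le_kerSubgroup_of_isAnticyclotomic K p)
    (hBr2 : ∀ (K : Type) [Field K] [NumberField K] (p : ℕ) [Fact p.Prime],
      ZpExtension.decomp_not_le_kerSubgroup_above_of_isAnticyclotomic K p)
    (hIrr : ∀ (W : WeierstrassCurve ℚ) [W.IsElliptic] [W.IsGloballyMinimal],
      ClassO6 W 3 → W.HasSurjectiveModNGaloisRep 3 → W.analyticRank = 1 →
      (∃ R : (W.baseChange ℚ_[3]).toAffine.Point, R ≠ 0 ∧ 3 • R = 0) →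
      ∀ (K : Type) [Field K] [NumberField K], IsImaginaryQuadratic K → SplitsIn K 3 →
      ∀ (𝔭 : HeightOneSpectrum (𝓞 K)), ((3 : ℕ) : 𝓞 K) ∈ 𝔭.asIdeal →
      ∀ N : AddSubgroup ((W.baseChange K).geomPrimaryTorsion 3),
        (∀ d ∈ decomp 𝔭, ∀ c ∈ N, d • c ∈ N) → (∀ c ∈ N, ∃ c' ∈ N, 3 • c' = c) →
        Set.ncard {c : (W.baseChange K).geomPrimaryTorsion 3 | c ∈ N ∧ 3 • c = 0} ≤ 3 → N = ⊥) :
    Summit.BirchSwinnertonDyer.BirchSwinnertonDyer.Theses.UniversalToricDescent.WildSplitControlAtThree :=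
  wildSplitControlAtThree_of_facts_of_noStableDivisibleLine hPT hPT2 hEP hcd hBr hBr2 hIrr
    fun W _ _ _ _ _ _ K _ _ hK hsplit κ _ 𝔭 h𝔭 ↦ by
      haveI : (W.baseChange K).IsElliptic := by rw [baseChange]; infer_instance
      obtain ⟨he', hf'⟩ := degreeOne_of_splitsIn hK.1 hsplit h𝔭
      exact (W.baseChange K).exists_pTorsion_not_fixed_of_degreeOne 3 κ 𝔭 (by decide) h𝔭 he' hf'

end Summit.BirchSwinnertonDyer.BirchSwinnertonDyer.Theorems.UniversalToricDescentControl

end
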